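import Summits.PneNP.PneNP.Theorems.SoloBlindCollapseHashing
import Summits.PneNP.PneNP.Theorems.SoloBlindOnlineCompression
import Summits.PneNP.PneNP.Theorems.SoloBlindPadMachine
import Summits.PneNP.PneNP.Theorems.SoloBlindFixedField
import Summits.PneNP.PneNP.Theorems.SoloBlindEquivalentForms
import Summits.PneNP.PneNP.Theorems.SoloBlindDiagonalEntry
import Literature.Computability.Complexity.Williams2014AccWitnesses
import Literature.Computability.Complexity.TM2PassThrough
import HarnessLib

/-!
# THEOREM E♯ (kernel form): under `NP ⊆ P`, every language of `P` streams in class-count space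

`cls L N p` is the ONE-PASS Myhill–Nerode class of the prefix `p` at input length `N`
(`SoloBlindStreamingNerode.lean`; a one-pass algorithm for `L` needs `≥ log₂ #classes` bits of
state, THEOREM B).  Suppose the classes of the length-`i` prefixes (`i ≤ N`) are met by at most
`2^{m N}` words.  **THEOREM E♯** (`SoloBlind.thmESharp`; ALGORITHM FORM `SoloBlind.thmESharp_alg`):
if `NP ⊆ P` and `L ∈ P` then `L ∈ USTREAM (m N + 2·size N + 2) (N ^ k + k)` for some `k` — ONE
polynomial-time uniform one-pass streaming algorithm (McKay–Murray–Williams model,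
`UniformStreaming.lean`) within `2·size N + 2 = O(log N)` bits of the information-theoretic minimum;
in the algorithm form the state is moreover a COMPLETE INVARIANT of the class of the prefix (same
state iff same class: exactly `#classes` reachable states per level).  `SoloBlind.thmESharp_PH`: the
same for `L ∈ PH` under `¬ PneNP`.  `SoloBlind.pneNP_of_streaming_tradeoff`: the contrapositive —
ONE language of `P` with a uniform one-pass TIME–SPACE trade-off of `ω(log N)` bits above its
class-count logarithm proves `P ≠ NP`.
Namespace `CCode` (Step 3): the NAME `enc N y = fld N |y| ++ h_j(y) ++ bin j` of a representative
(fixed-width field `fld N i = bin (i + 2^{size N})` of `size N + 1` bits, isolating index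
`j = j(N, y) < k⋆`; `enc`, `codeFP_enc`, `length_enc_le`) and a polynomial-time DECODER (`exists_dec`,
uniqueness = isolation).  Steps 1–2 (canonical representatives; Sipser isolation by `k⋆ ≤ m N + 1`
parities found by search) are `SoloBlindCollapseReps/Hashing.lean`; the machine is `OC.alg`
(`SoloBlindOnlineCompression.lean`) realised in `TM2` by the padding loop of `SoloBlindPadMachine.lean`.
All statements proved; hypotheses displayed.
References: M. Sipser, *A complexity theoretic approach to randomness*, STOC 1983; S. Arora,
B. Barak, *Computational Complexity: A Modern Approach*, CUP 2009, Thm. 2.18, Thm. 5.4, §6.1;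
D. M. McKay, C. D. Murray, R. R. Williams, *Weak lower bounds on resource-bounded compression imply
strong separations of complexity classes*, STOC 2019, §2.
-/

namespace Summit.PneNP.PneNP.Theorems.SoloBlind

open Polynomial
open Literature.Computability.Complexity Literature.Computability.MetaComplexity
open Literature.Computability.MetaComplexity.McKayMurrayWilliams2019
open Literature.Computability.Complexity.CodeFP (natE unE bitE pairE rawE strE pairE_apply length_unE)

namespace CCode

variable {rep : ℕ → List Bool → List Bool} {wS : ℕ → ℕ → List Bool} {jS : ℕ → List Bool → ℕ}

/-- The NAME of a canonical representative `y`: empty for `y = []`, else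
`fld N |y| ++ h_{j(N,y)}(y) ++ bin j(N,y)` with the hash matrix taken from the family `w⋆(N, |y|)`
of `k⋆(N, |y|)` functions (the middle block has the known length `k⋆`). [Sipser 1983] [folklore] -/
noncomputable def enc (rep : ℕ → List Bool → List Bool) (wS : ℕ → ℕ → List Bool)
    (jS : ℕ → List Bool → ℕ) (N : ℕ) (y : List Bool) : List Bool :=
  if y = [] then [] else fld N y.length ++
    (StrHash.shash (StrFam.mat (CHash.kStar rep N y.length) y.length (wS N y.length) (jS N y)) y ++
      natE (jS N y))

/-- `enc N [] = []`. [folklore] -/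
@[simp] theorem enc_nil (N : ℕ) : enc rep wS jS N [] = [] := if_pos rfl

/-- `enc N y` for `y ≠ []`. [folklore] -/
theorem enc_of_ne_nil {N : ℕ} {y : List Bool} (hy : y ≠ []) :
    enc rep wS jS N y = fld N y.length ++ (StrHash.shash (StrFam.mat (CHash.kStar rep N y.length)
      y.length (wS N y.length) (jS N y)) y ++ natE (jS N y)) :=
  if_neg hy

/-- `enc N y ≠ []` for `y ≠ []`. [folklore] -/
theorem enc_ne_nil {N : ℕ} {y : List Bool} (hy : y ≠ []) : enc rep wS jS N y ≠ [] := by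
  intro h
  rw [enc_of_ne_nil hy] at h
  exact fld_ne_nil N y.length (List.append_eq_nil_iff.1 h).1

/-- **Length of a name**: `|enc N y| ≤ size N + 1 + k⋆(N,|y|) + size j(N,y)` for `|y| ≤ N`.
[folklore] -/
theorem length_enc_le {N : ℕ} {y : List Bool} (hyN : y.length ≤ N) : (enc rep wS jS N y).length ≤
    Nat.size N + 1 + CHash.kStar rep N y.length + Nat.size (jS N y) := by
  by_cases hy : y = []
  · subst hy
    simp
  · rw [enc_of_ne_nil hy]
    simp only [List.length_append, StrHash.length_shash, StrFam.length_mat, length_fld hyN]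
    have h2 := TM2Pass.length_encodeNat_eq_size (jS N y)
    simp only [CodeFP.natE]
    omega

/-- **The encoder is polynomial time** (on codes `⟨1ᴺ, y⟩`), under `NP ⊆ P`.
[cite: AroraBarak2009, §1.3, Thm. 2.18] -/
theorem codeFP_enc (hNP : Nondeterministic.NP ⊆ Classes.P)
    (hrepC : CodeFP (pairE unE strE) strE (fun a => rep a.1 a.2))
    (hwC : CodeFP (pairE unE unE) strE (fun a => wS a.1 a.2))
    (hjC : CodeFP (pairE unE strE) natE (fun a => jS a.1 a.2)) :
    CodeFP (pairE unE strE) strE (fun a => enc rep wS jS a.1 a.2) := by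
  have hN := CodeFP.fst unE strE
  have hy := CodeFP.snd unE strE
  have hi := CodeFP.strLength.comp hy
  have hiN := CodeFP.strNatLength.comp hy
  have hk := (CHash.codeFP_kStar hNP hrepC).comp (hN.pair hi)
  have hw := hwC.comp (hN.pair hi)
  have hM := StrFam.codeFP_mat.comp (hk.pair (hi.pair (hw.pair hjC)))
  have hh := StrHash.codeFP_shash.comp (hM.pair hy)
  have hf := codeFP_fld.comp (hN.pair hiN)
  have hj := CodeFP.strOfNat.comp hjC
  have hbody : CodeFP (pairE unE strE) strE (fun a => fld a.1 a.2.length ++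
      (StrHash.shash (StrFam.mat (CHash.kStar rep a.1 a.2.length) a.2.length (wS a.1 a.2.length)
        (jS a.1 a.2)) a.2 ++ natE (jS a.1 a.2))) :=
    CodeFP.strAppend.comp (hf.pair (CodeFP.strAppend.comp (hh.pair hj)))
  have hnil : CodeFP (pairE unE strE) bitE (fun a => decide (a.2 = [])) :=
    (CodeFP.eq (eα := strE) Function.injective_id).comp (hy.pair (CodeFP.const _ []))
  exact (CodeFP.ite hnil (CodeFP.const (eβ := strE) _ []) hbody).congr fun a => by
    simp only [enc, decide_eq_true_eq]

open scoped Classical in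
/-- **A polynomial-time decoder.** Under `NP ⊆ P`: some polynomial-time `dec` with `dec N [] = []`
recovers every canonical representative `y` of length `≤ N` from its name, `dec N (enc N y) = y`
(parse `|y|` from the fixed-width field, then `h` and `j` by the known length `k⋆`, and search for
the unique representative of that length with `h_j = h`; uniqueness is isolation).
[cite: AroraBarak2009, Thm. 2.18, Thm. 5.4] -/
theorem exists_dec (hNP : Nondeterministic.NP ⊆ Classes.P)
    (hrepC : CodeFP (pairE unE strE) strE (fun a => rep a.1 a.2))
    (hwC : CodeFP (pairE unE unE) strE (fun a => wS a.1 a.2))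
    (hjS : ∀ N y, rep N y = y → jS N y < CHash.kStar rep N y.length ∧
      y ∈ CHash.isolSet rep N y.length (CHash.kStar rep N y.length) (wS N y.length) (jS N y)) :
    ∃ dec : ℕ → List Bool → List Bool, CodeFP (pairE unE strE) strE (fun a => dec a.1 a.2) ∧
      (∀ N, dec N [] = []) ∧
      ∀ N y, rep N y = y → y.length ≤ N → dec N (enc rep wS jS N y) = y := by
  -- context `(N, σ)`, witness `z`
  have hc := CodeFP.fst (pairE unE strE) strE
  have hz := CodeFP.snd (pairE unE strE) strE
  have hN := hc.fst'
  have hσ := hc.snd'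
  have hwd := CodeFP.unSucc.comp (codeFP_size.comp hN)
  have hiσ : CodeFP (pairE (pairE unE strE) strE) natE
      (fun t => bitsToNat (t.1.2.take (Nat.size t.1.1 + 1)) - 2 ^ Nat.size t.1.1) :=
    CodeFP.natSub.comp ((CodeFP.strVal.comp (CodeFP.strTake.comp (hwd.pair hσ))).pair
      (CodeFP.natPow.comp ((CodeFP.const (eβ := natE) _ 2).pair (codeFP_size.comp hN))))
  have hrest := CodeFP.strDrop.comp (hwd.pair hσ)
  have hi := CodeFP.strLength.comp hz
  have hk := (CHash.codeFP_kStar hNP hrepC).comp (hN.pair hi)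
  have hw := hwC.comp (hN.pair hi)
  have hhσ := CodeFP.strTake.comp (hk.pair hrest)
  have hjσ := CodeFP.strVal.comp (CodeFP.strDrop.comp (hk.pair hrest))
  have hlen : CodeFP (pairE (pairE unE strE) strE) bitE (fun t =>
      decide (t.2.length = bitsToNat (t.1.2.take (Nat.size t.1.1 + 1)) - 2 ^ Nat.size t.1.1)) :=
    CodeFP.natEq.comp ((CodeFP.strNatLength.comp hz).pair hiσ)
  have hrep : CodeFP (pairE (pairE unE strE) strE) bitE
      (fun t => decide (t.2.length = t.2.length ∧ rep t.1.1 t.2 = t.2)) :=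
    (CReps.codeFP_isRep hrepC).comp (hN.pair (hi.pair hz))
  have hM := StrFam.codeFP_mat.comp (hk.pair (hi.pair (hw.pair hjσ)))
  have hh := StrHash.codeFP_shash.comp (hM.pair hz)
  have hhv : CodeFP (pairE (pairE unE strE) strE) bitE
      (fun t => StrHash.shash (StrFam.mat (CHash.kStar rep t.1.1 t.2.length) t.2.length
        (wS t.1.1 t.2.length) (bitsToNat (((t.1.2.drop (Nat.size t.1.1 + 1)).drop
          (CHash.kStar rep t.1.1 t.2.length))))) t.2 ==
            (t.1.2.drop (Nat.size t.1.1 + 1)).take (CHash.kStar rep t.1.1 t.2.length)) :=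
    (CodeFP.beq (eα := strE) Function.injective_id).comp (hh.pair hhσ)
  obtain ⟨g, hgC, hgood, -⟩ := Collapse.search hNP (hlen.and (hrep.and hhv)) X
  have hnil : CodeFP (pairE unE strE) bitE (fun a => decide (a.2 = [])) :=
    (CodeFP.eq (eα := strE) Function.injective_id).comp
      ((CodeFP.snd unE strE).pair (CodeFP.const _ []))
  refine ⟨fun N σ => if σ = [] then [] else g (N, σ),
    (CodeFP.ite hnil (CodeFP.const (eβ := strE) _ []) hgC).congr fun a => by
      simp only [decide_eq_true_eq],
    fun N => if_pos rfl, fun N y hyr hyN => ?_⟩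
  by_cases hy0 : y = []
  · subst hy0
    simp
  obtain ⟨-, hjiso⟩ := hjS N y hyr
  show (if enc rep wS jS N y = [] then [] else g (N, enc rep wS jS N y)) = y
  rw [if_neg (enc_ne_nil hy0)]
  -- parsing the name of `y`
  have hF := length_fld (x := y.length) hyN
  have hH : (StrHash.shash (StrFam.mat (CHash.kStar rep N y.length) y.length (wS N y.length)
      (jS N y)) y).length = CHash.kStar rep N y.length := by
    simp only [StrHash.length_shash, StrFam.length_mat]
  have htake : (enc rep wS jS N y).take (Nat.size N + 1) = fld N y.length := by
    rw [enc_of_ne_nil hy0, List.take_append_of_le_length (by rw [hF]),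
      List.take_of_length_le (by rw [hF])]
  have hdrop : (enc rep wS jS N y).drop (Nat.size N + 1) = StrHash.shash (StrFam.mat
      (CHash.kStar rep N y.length) y.length (wS N y.length) (jS N y)) y ++ natE (jS N y) := by
    rw [enc_of_ne_nil hy0, List.drop_append_of_le_length (by rw [hF]),
      List.drop_of_length_le (by rw [hF]), List.nil_append]
  have hT : (StrHash.shash (StrFam.mat (CHash.kStar rep N y.length) y.length (wS N y.length)
      (jS N y)) y ++ natE (jS N y)).take (CHash.kStar rep N y.length) = StrHash.shash (StrFam.mat
        (CHash.kStar rep N y.length) y.length (wS N y.length) (jS N y)) y := by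
    rw [List.take_append_of_le_length (by rw [hH]), List.take_of_length_le (by rw [hH])]
  have hD : (StrHash.shash (StrFam.mat (CHash.kStar rep N y.length) y.length (wS N y.length)
      (jS N y)) y ++ natE (jS N y)).drop (CHash.kStar rep N y.length) = natE (jS N y) := by
    rw [List.drop_append_of_le_length (by rw [hH]), List.drop_of_length_le (by rw [hH]),
      List.nil_append]
  -- the predicate holds at `y`
  have hex : ∃ z : List Bool, z.length ≤ X.eval (pairE unE strE (N, enc rep wS jS N y)).length ∧
      (decide (z.length = bitsToNat ((((N, enc rep wS jS N y), z).1.2.take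
        (Nat.size ((N, enc rep wS jS N y), z).1.1 + 1))) -
          2 ^ Nat.size ((N, enc rep wS jS N y), z).1.1) &&
        (decide (z.length = z.length ∧ rep ((N, enc rep wS jS N y), z).1.1 z = z) &&
          (StrHash.shash (StrFam.mat (CHash.kStar rep N z.length) z.length (wS N z.length)
            (bitsToNat (((((N, enc rep wS jS N y), z).1.2.drop
              (Nat.size ((N, enc rep wS jS N y), z).1.1 + 1)).drop
                (CHash.kStar rep N z.length))))) z ==
                  ((((N, enc rep wS jS N y), z).1.2.drop
                    (Nat.size ((N, enc rep wS jS N y), z).1.1 + 1)).take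
                      (CHash.kStar rep N z.length))))) = true := by
    refine ⟨y, ?_, ?_⟩
    · simp only [eval_X, pairE_apply, length_boolPair, length_unE]
      omega
    · simp only [htake, bitsToNat_fld, hdrop, hT, hD, CodeFP.bitsToNat_natE, hyr,
        Bool.and_eq_true, decide_eq_true_eq, beq_self_eq_true, and_self]
  have hP := (hgood (N, enc rep wS jS N y) hex).2
  simp only [Bool.and_eq_true, decide_eq_true_eq, beq_iff_eq, true_and] at hP
  obtain ⟨hl, hr, hh⟩ := hP
  rw [htake, bitsToNat_fld] at hl
  rw [hl, hdrop, hD, hT, CodeFP.bitsToNat_natE] at hh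
  by_contra hne
  exact hjiso _ ⟨hl, hr⟩ hne hh

end CCode

namespace ESharp

variable {L : Language Bool}

/-- `(C 4 * X + C 2).eval N = 4 N + 2`. [folklore] -/
theorem eval_lin (N : ℕ) : (C 4 * X + C 2 : Polynomial ℕ).eval N = 4 * N + 2 := by
  simp [eval_add, eval_mul, eval_X]

/-- **Space bound of the names.** For the canonical `rep`, the isolating data `w⋆, j` and a
`2ᴹ` class cover of the length-`|p|` prefixes: `|enc N (rep N p)| ≤ M + 2·size N + 2` when
`|p| ≤ N`. [folklore] -/
theorem length_enc_rep_le {rep : ℕ → List Bool → List Bool} {wS : ℕ → ℕ → List Bool}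
    {jS : ℕ → List Bool → ℕ}
    (hR1 : ∀ N p, rep N p ∈ NerodeStream.cls L N p)
    (hR2 : ∀ N p p', p' ∈ NerodeStream.cls L N p → rep N p' = rep N p)
    (hjS : ∀ N y, rep N y = y → jS N y < CHash.kStar rep N y.length ∧
      y ∈ CHash.isolSet rep N y.length (CHash.kStar rep N y.length) (wS N y.length) (jS N y))
    {N M : ℕ} {p : List Bool} (hp : p.length ≤ N) {R : Finset (List Bool)} (hRc : R.card ≤ 2 ^ M)
    (hcov : ∀ q : List Bool, q.length = p.length → ∃ r ∈ R, r ∈ NerodeStream.cls L N q) :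
    (CCode.enc rep wS jS N (rep N p)).length ≤ M + 2 * Nat.size N + 2 := by
  have hfix := CReps.rep_rep hR1 hR2 N p
  have hlen : (rep N p).length = p.length := NerodeStream.length_eq_of_mem_cls (hR1 N p)
  have h1 := CCode.length_enc_le (rep := rep) (wS := wS) (jS := jS) (N := N) (y := rep N p)
    (by omega)
  have h2 := (hjS N (rep N p) hfix).1
  have h3 := CHash.kStar_le_succ rep N (rep N p).length
  have h4 : CHash.kStar rep N (rep N p).length ≤ M + 1 :=
    CHash.kStar_le_of_cover hR2 hRc (by rw [hlen]; exact hcov)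
  have h5 : Nat.size (rep N p).length ≤ Nat.size N := Nat.size_le_size (by omega)
  have h6 : Nat.size (jS N (rep N p)) ≤ Nat.size N := Nat.size_le_size (by omega)
  omega

/-- **Crude space bound of the names** (for the time analysis): `|enc N (rep N p)| ≤ 3 N + 2`.
[folklore] -/
theorem length_enc_rep_le' {rep : ℕ → List Bool → List Bool} {wS : ℕ → ℕ → List Bool}
    {jS : ℕ → List Bool → ℕ}
    (hR1 : ∀ N p, rep N p ∈ NerodeStream.cls L N p)
    (hR2 : ∀ N p p', p' ∈ NerodeStream.cls L N p → rep N p' = rep N p)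
    (hjS : ∀ N y, rep N y = y → jS N y < CHash.kStar rep N y.length ∧
      y ∈ CHash.isolSet rep N y.length (CHash.kStar rep N y.length) (wS N y.length) (jS N y))
    {N : ℕ} {p : List Bool} (hp : p.length ≤ N) :
    (CCode.enc rep wS jS N (rep N p)).length ≤ 3 * N + 2 := by
  have hfix := CReps.rep_rep hR1 hR2 N p
  have hlen : (rep N p).length = p.length := NerodeStream.length_eq_of_mem_cls (hR1 N p)
  have h1 := CCode.length_enc_le (rep := rep) (wS := wS) (jS := jS) (N := N) (y := rep N p)
    (by omega)
  have h2 := (hjS N (rep N p) hfix).1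
  have h3 := CHash.kStar_le_succ rep N (rep N p).length
  have h5 : Nat.size (rep N p).length ≤ Nat.size N := Nat.size_le_size (by omega)
  have h6 : Nat.size (jS N (rep N p)) ≤ Nat.size N := Nat.size_le_size (by omega)
  have h7 : Nat.size N ≤ N := Nat.size_le.2 Nat.lt_two_pow_self
  omega

end ESharp

/-- **THEOREM E♯, algorithm form (BY A COMPLETE CLASS INVARIANT).** If `NP ⊆ P`, `L ∈ P`, and for
all `i ≤ N` the one-pass Myhill–Nerode classes of the length-`i` prefixes at input length `N` are met
by at most `2^{m N}` words, then there are `k` and ONE uniform one-pass streaming algorithm `A` (empty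
initial state) deciding `L` with state `≤ m N + 2·size N + 2` bits and update / report time
`N ^ k + k`, whose state after a prefix `p` (`|p| ≤ N`) is a COMPLETE INVARIANT of the class of `p`
(same state iff equivalent): EXACTLY `#classes` reachable states at every level, only the LENGTH of
their names exceeds `log₂ #classes`, by at most `2·size N + 2`.
[cite: AroraBarak2009, Thm. 2.18 and Thm. 5.4; McKayMurrayWilliams2019, §2 (Streaming Algorithms)] -/
theorem thmESharp_alg (hNP : Nondeterministic.NP ⊆ Classes.P) {L : Language Bool}
    (hL : L ∈ Classes.P) {m : ℕ → ℕ} (hm : ∀ N i, i ≤ N → ∃ R : Finset (List Bool),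
      R.card ≤ 2 ^ m N ∧ ∀ p : List Bool, p.length = i → ∃ r ∈ R, r ∈ NerodeStream.cls L N p) :
    ∃ (k : ℕ) (A : StreamingAlgorithm), (∀ N, A.init N = []) ∧
      RunsInSpace A (fun N => m N + 2 * Nat.size N + 2) ∧
      HasUniformUpdateTime A (fun N => N ^ k + k) ∧ HasUniformReportTime A (fun N => N ^ k + k) ∧
      A.Decides L ∧
      ∀ (N : ℕ) (p p' : List Bool), p.length ≤ N → p'.length ≤ N →
        (reach A N p = reach A N p' ↔ p' ∈ NerodeStream.cls L N p) := by
  classical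
  -- the data: canonical representatives, separating strings, isolating indices, decoder
  obtain ⟨rep, hrepC, hR1, hR2⟩ := CReps.exists_rep hNP hL
  obtain ⟨wS, hwC, hwS⟩ := CHash.exists_wStar hNP hrepC
  obtain ⟨jS, hjC, hjS⟩ := CHash.exists_jS hNP hrepC hwC fun N i => (hwS N i).2
  obtain ⟨dec, hdecC, hdec0, hdecD⟩ := CCode.exists_dec hNP hrepC hwC hjS
  have hencC := CCode.codeFP_enc hNP hrepC hwC hjC
  -- the online-compression machine and its hypotheses
  have hR1' : ∀ N p, p.length ≤ N → rep N p ∈ NerodeStream.cls L N p := fun N p _ => hR1 N p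
  have hR2' : ∀ N p p', p.length ≤ N → p' ∈ NerodeStream.cls L N p → rep N p' = rep N p :=
    fun N p p' _ h => hR2 N p p' h
  have hE0 : ∀ N, CCode.enc rep wS jS N [] = [] := fun N => CCode.enc_nil N
  have hD : ∀ N p, p.length ≤ N →
      dec N (CCode.enc rep wS jS N (rep N p)) = rep N p := fun N p hp =>
    hdecD N (rep N p) (CReps.rep_rep hR1 hR2 N p)
      (by rw [NerodeStream.length_eq_of_mem_cls (hR1 N p)]; exact hp)
  have hSpace : RunsInSpace (OC.alg L rep (CCode.enc rep wS jS) dec)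
      (fun N => m N + 2 * Nat.size N + 2) :=
    OC.runsInSpace_alg hR1' hR2' hE0 hD fun N p hp => by
      obtain ⟨R, hRc, hcov⟩ := hm N p.length hp
      exact ESharp.length_enc_rep_le hR1 hR2 hjS hp hRc hcov
  have hSpace' : RunsInSpace (OC.alg L rep (CCode.enc rep wS jS) dec) (fun N => 3 * N + 2) :=
    OC.runsInSpace_alg hR1' hR2' hE0 hD fun N p hp => ESharp.length_enc_rep_le' hR1 hR2 hjS hp
  -- the update map and the report map as `CodeFP` functions of `(1ᴺ, bin N, state, bit)`
  have hN := CodeFP.fst unE (pairE natE (pairE strE bitE))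
  have hσ := (CodeFP.snd unE (pairE natE (pairE strE bitE))).snd'.fst'
  have hb : CodeFP (pairE unE (pairE natE (pairE strE bitE))) strE (fun t => [t.2.2.2]) :=
    (CodeFP.snd unE (pairE natE (pairE strE bitE))).snd'.snd'.recodeOut fun _ => rfl
  have hu : CodeFP (pairE unE (pairE natE (pairE strE bitE))) strE (fun t =>
      CCode.enc rep wS jS t.1 (rep t.1 (dec t.1 t.2.2.1 ++ [t.2.2.2]))) :=
    hencC.comp (hN.pair (hrepC.comp (hN.pair (CodeFP.strAppend.comp
      ((hdecC.comp (hN.pair hσ)).pair hb)))))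
  obtain ⟨qu, hqu⟩ := Pad.hasUniformUpdateTime_of_codeFP
    (A := OC.alg L rep (CCode.enc rep wS jS) dec) hu
    (fun N x b _ => by rw [reach_append_singleton]; rfl) hSpace'
  have hN' := CodeFP.fst unE (pairE natE strE)
  have hσ' := (CodeFP.snd unE (pairE natE strE)).snd'
  have hr : CodeFP (pairE unE (pairE natE strE)) bitE
      (fun t => L.boolIndicator (dec t.1 t.2.2)) :=
    (Collapse.indicator hL).comp (hdecC.comp (hN'.pair hσ'))
  obtain ⟨qr, hqr⟩ := Pad.hasUniformReportTime_of_codeFP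
    (A := OC.alg L rep (CCode.enc rep wS jS) dec) hr (fun x => rfl) hSpace'
  -- one polynomial time bound for both machines
  obtain ⟨e, he⟩ := exists_eval_le_pow_add_self ((qu + qr).comp (C 4 * X + C 2))
  refine ⟨e, OC.alg L rep (CCode.enc rep wS jS) dec, fun _ => rfl, hSpace, ?_, ?_,
    OC.decides_alg hR1' hR2' hE0 hD, fun N p p' hp hp' => ?_⟩
  · obtain ⟨M, hM⟩ := hqu
    refine ⟨M, fun N x b hx => (hM N x b hx).mono (le_trans ?_ (he N))⟩
    show qu.eval (N + (3 * N + 2)) ≤ ((qu + qr).comp (C 4 * X + C 2)).eval N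
    rw [eval_comp, ESharp.eval_lin, eval_add, show N + (3 * N + 2) = 4 * N + 2 by ring]
    omega
  · obtain ⟨M, hM⟩ := hqr
    refine ⟨M, fun x => (hM x).mono (le_trans ?_ (he x.length))⟩
    show qr.eval (x.length + (3 * x.length + 2)) ≤
      ((qu + qr).comp (C 4 * X + C 2)).eval x.length
    rw [eval_comp, ESharp.eval_lin, eval_add,
      show x.length + (3 * x.length + 2) = 4 * x.length + 2 by ring]
    omega
  · -- the state is the name of the canonical representative: a complete class invariant
    rw [OC.reach_alg hR1' hR2' hE0 hD hp, OC.reach_alg hR1' hR2' hE0 hD hp']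
    refine ⟨fun h => ?_, fun h => by rw [hR2' N p p' hp h]⟩
    have h1 : rep N p' = rep N p := by rw [← hD N p hp, ← hD N p' hp', h]
    have h2 : rep N p' ∈ NerodeStream.cls L N p := h1 ▸ hR1 N p
    exact NerodeStream.mem_cls_trans h2 (NerodeStream.mem_cls_symm (hR1 N p'))

/-- **THEOREM E♯ (under `NP ⊆ P`, every language of `P` streams in class-count space with
polynomial uniform update time).** If `NP ⊆ P`, `L ∈ P`, and for all `i ≤ N` the one-pass classes of
the length-`i` prefixes at input length `N` are met by at most `2^{m N}` words, then
`L ∈ USTREAM (m N + 2·size N + 2) (N ^ k + k)` for some `k`. [cite: AroraBarak2009, Thm. 2.18 and Thm. 5.4; McKayMurrayWilliams2019, §2] -/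
theorem thmESharp (hNP : Nondeterministic.NP ⊆ Classes.P) {L : Language Bool} (hL : L ∈ Classes.P)
    {m : ℕ → ℕ} (hm : ∀ N i, i ≤ N → ∃ R : Finset (List Bool), R.card ≤ 2 ^ m N ∧
      ∀ p : List Bool, p.length = i → ∃ r ∈ R, r ∈ NerodeStream.cls L N p) :
    ∃ k : ℕ, L ∈ USTREAM (fun N => m N + 2 * Nat.size N + 2) (fun N => N ^ k + k) := by
  obtain ⟨k, A, h0, hS, hU, hR, hdec, -⟩ := thmESharp_alg hNP hL hm
  exact ⟨k, A, h0, hS, hU, hR, hdec⟩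

/-- **THEOREM E♯, `PH` form.** If `P = NP` (`¬ PneNP`), then every `L ∈ PH` whose one-pass class
counts are bounded by `2^{m N}` as above is in `USTREAM (m N + 2·size N + 2) (N ^ k + k)` for some
`k`. Contrapositive: a uniform one-pass TIME–SPACE trade-off of `ω(log N)` bits above the
class-count logarithm for ONE language of `PH` proves `P ≠ NP`.
[cite: AroraBarak2009, Thm. 5.4; McKayMurrayWilliams2019, §2] -/
theorem thmESharp_PH (h : ¬ PneNP) {L : Language Bool} (hL : L ∈ PH)
    {m : ℕ → ℕ} (hm : ∀ N i, i ≤ N → ∃ R : Finset (List Bool), R.card ≤ 2 ^ m N ∧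
      ∀ p : List Bool, p.length = i → ∃ r ∈ R, r ∈ NerodeStream.cls L N p) :
    ∃ k : ℕ, L ∈ USTREAM (fun N => m N + 2 * Nat.size N + 2) (fun N => N ^ k + k) := by
  have hNP : Nondeterministic.NP ⊆ Classes.P := not_not.1 (pneNP_iff_not_NP_subset_P.not.1 h)
  have hPNP : Classes.P = Nondeterministic.NP := not_not.1 (SoloBlind.pneNP_iff_P_ne_NP.not.1 h)
  have hL' : L ∈ Classes.P := by rwa [SoloBlind.PH_eq_P_of_P_eq_NP hPNP] at hL
  exact thmESharp hNP hL' hm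

/-- **THEOREM E♯, summit-directed contrapositive.** If some `L ∈ P` with one-pass class counts
`≤ 2^{m N}` admits, for NO `k`, a uniform one-pass streaming algorithm with state
`≤ m N + 2·size N + 2` bits and update / report time `N ^ k + k`, then `P ≠ NP`.
[cite: AroraBarak2009, Thm. 2.18; McKayMurrayWilliams2019, §2] -/
theorem pneNP_of_streaming_tradeoff {L : Language Bool} (hL : L ∈ Classes.P) {m : ℕ → ℕ}
    (hm : ∀ N i, i ≤ N → ∃ R : Finset (List Bool), R.card ≤ 2 ^ m N ∧
      ∀ p : List Bool, p.length = i → ∃ r ∈ R, r ∈ NerodeStream.cls L N p)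
    (hno : ∀ k : ℕ, L ∉ USTREAM (fun N => m N + 2 * Nat.size N + 2) (fun N => N ^ k + k)) :
    PneNP := by
  by_contra h
  have hNP : Nondeterministic.NP ⊆ Classes.P := not_not.1 (pneNP_iff_not_NP_subset_P.not.1 h)
  obtain ⟨k, hk⟩ := thmESharp hNP hL hm
  exact hno k hk

end Summit.PneNP.PneNP.Theorems.SoloBlind
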